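import Mathlib.Algebra.MvPolynomial.PDeriv
import Mathlib.Algebra.Polynomial.Degree.Operations
import Summits.Ventures.HSemireg.EmbeddedFirstOrderDeformationsTwistedAtlas

/-!
# Venture HSemireg — a WITNESS with NON-ZERO Čech obstruction class: the doubled line in the sheared doubled plane
# does not lift (Hartshorne, *Deformation Theory*, Thm. 6.2 (b): the obstruction `α ∈ H¹(Y₀, 𝒩₀ ⊗ J)` CAN be non-zero)

HONEST FRAMING.  Lean side of the computation cell `pub-hsemireg` (track «S4-PUSH» (ii), seat s4-prove-3 g6, second
route for (S5)); log `s4push/prove-3/ATTEMPT-10.md` §5c (s4-ref g35 P-1/P-2/P-3 folded).  A concrete instance of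
the abstract thickened atlas of `…CechObstruction` / `…TwistedAtlas` built from `k[s, p]` and its localisation
`k[s, s⁻¹, p]`; the scheme it presents is NOT separated (two copies of `𝔸²` glued along `D(s)`) — chosen because
both chart-to-overlap maps are then the canonical localisation, so every atlas hypothesis is discharged by the
landed dischargers; the separated textbook twin (the `(−2)`-curve: one more chart isomorphism `s ↦ s⁻¹, p ↦ s²p`)
is `…CechMinusTwoCurve`, which imports this file.  No Mathlib scheme, sheaf, abelian variety or semiregularity map;
nothing here says that HC, HC_CM or HC_AV holds; no object is certified; no Literature fact is declared.

THE EXAMPLE.  `k` a non-trivial commutative ring, `A = k[s, p]` (`s = X 0`, `p = X 1`), `L = A_s`.  Charts `U₀ = U₁ =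
Spec A`, overlap `U₀₁ = Spec L` with BOTH restrictions the localisation map; the first-order deformation `X_ξ` is the
twisted dual-number atlas (`thickenedAtlas_twisted`) with `θ₀₁ = s⁻¹·∂/∂p` (a derivation of `L`, §1), `θ₁₀ = −θ₀₁`,
`θ_αα = 0`; the subscheme is `Z = V(p)` (the affine line with doubled origin), `I = (p)`, `I_L = (p)·L`.  By
`exists_isAtlasLift_twisted_iff` (PROP. K for `X_ξ`), `Z` lifts iff `θ̄₀₁|_{I_L} : p ↦ s⁻¹ (mod p)` is a coboundary
`φ₁| − φ₀|`; but `φ_α(p) ∈ A/(p) = k[s]` restricts to a POLYNOMIAL in `s`, and `s⁻¹ ≡ G₁(s) − G₀(s) (mod p)` is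
impossible: under `L → k[x]_x`, `s ↦ x`, `p ↦ 0` it says `x·G = 1` in `k[x]`.  So the Čech class
`[s⁻¹] ∈ Ȟ¹ = k[s,s⁻¹] / k[s]` (both charts contribute polynomials in `s` here; in the separated twin the second
chart contributes `s⁻²·k[s⁻¹]`) is NON-ZERO and **`Z` does NOT lift**: `not_exists_isAtlasLift_doubledLine`.
By contrast the UNTWISTED doubled plane (`θ = 0`) does carry a lift of `Z`
(`exists_isAtlasLift_doubledLine_untwisted`): the pair is a clean zero / non-zero dichotomy.

WHAT (namespace `Summit.Ventures.HSemireg.EmbeddedDeformation`, §1–§2 in `….DoubledLine`):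
* §0 (generic; placed here so that every later example file imports THIS file directly) `IsLift.map_ringEquivPair`
  — flat lifts transport along a pair of ring isomorphisms intertwining the thickening maps (the base may move) —,
  `mapRingEquiv ψ : A[ε] ≃+* B[ε]`, `mapRingHom_comp'`; and (§2) `eval₂Hom_pair_zero` (evaluation at `(u, 0)`).
* §1 `derivHom₀ c : A →+* L[ε]`, `a ↦ a/1 + ε·c·(∂a/∂p)/1`; `derivHom c : L →+* L[ε]` its extension (`s/1` is sent to
  a unit); `theta c : Derivation ℤ L L`, `theta c z := (derivHom c z).snd` — the derivation `c·∂/∂p` on `L = A_s`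
  (`theta_algebraMap`: `theta c (a/1) = c·(∂a/∂p)/1`).
* §2 `thickenedAtlas_doubledLine` (it IS a thickened atlas), `isLift_trivialLift_doubledLine` (local lifts exist),
  `exists_isAtlasLift_doubledLine_untwisted` (θ = 0: a lift EXISTS — positive companion),
  **`not_exists_isAtlasLift_doubledLine`** — for `c = s⁻¹` (`invSelf`) the twisted atlas above has NO lift of `Z`
  (the RHS of `exists_isAtlasLift_twisted_iff` is refuted by evaluating at `p` and mapping to `k[x]_x`), and
  **`cechCochain_doubledLine_not_coboundary`** — the Čech cochain of the trivial local lifts is NOT a coboundary.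
So the failure side of Thm. 6.2 (b) / (T1) is INHABITED in the lineage's own vocabulary: an atlas, local lifts
(the trivial ones `I·A[ε]`), and a cochain that is provably not a coboundary.

References: R. Hartshorne, *Deformation Theory*, GTM 257 (2010), §6 Thm. 6.2 (b) [corpus:
book:springernd-deformation-theory p0054]; the example is the affine shadow of «the zero section of `𝒪_{ℙ¹}(−2)` does
not survive the smoothing of the `A₁`-singularity» [folklore].
-/

namespace Summit.Ventures.HSemireg

namespace EmbeddedDeformation

/-! ### §0 Transport of flat lifts along a pair of ring isomorphisms (generic; used by every example file) -/

section Transport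
open DualNumber TrivSqZeroExt
universe u v u' v'
variable {R' : Type u} {R : Type v} {S' : Type u'} {S : Type v'}
variable [CommRing R'] [CommRing R] [CommRing S'] [CommRing S]
variable {π : R' →+* R} {e : R'} {τ : S' →+* S} {e' : S'}

/-- **Flat lifts transport along isomorphisms of thickenings over an isomorphism of bases**: if `ψ' : R' ≃ S'` and
`ψ : R ≃ S` satisfy `τ ∘ ψ' = ψ ∘ π` and `ψ' e = e'`, then `ψ'(K)` is a flat lift of `ψ(I)` whenever `K` is one of `I`
(`…Restriction`'s `IsLift.map_ringEquiv` is the case `ψ = id`). [folklore] -/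
theorem IsLift.map_ringEquivPair (ψ' : R' ≃+* S') (ψ : R ≃+* S) (hc : ∀ z, τ (ψ' z) = ψ (π z)) (he : ψ' e = e')
    {I : Ideal R} {K : Ideal R'} (hK : IsLift π e I K) :
    IsLift τ e' (I.map (ψ : R →+* S)) (K.map (ψ' : R' →+* S')) where
  map_mem z hz := by
    rw [mem_map_ringEquiv_iff] at hz
    rw [← ψ'.apply_symm_apply z, hc]
    exact Ideal.mem_map_of_mem _ (hK.map_mem _ hz)
  exists_mem x hx := by
    rw [mem_map_ringEquiv_iff] at hx
    obtain ⟨w, hw, hπw⟩ := hK.exists_mem _ hx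
    refine ⟨ψ' w, (mem_map_ringEquiv_iff ψ' K _).2 (by rwa [RingEquiv.symm_apply_apply]), ?_⟩
    rw [hc, hπw, RingEquiv.apply_symm_apply]
  eps_flat z hz := by
    rw [mem_map_ringEquiv_iff, map_mul, ← he, RingEquiv.symm_apply_apply] at hz
    obtain ⟨w, hw⟩ := hK.eps_flat _ hz
    refine ⟨ψ' w, (mem_map_ringEquiv_iff ψ' K _).2 ?_⟩
    rwa [map_sub, map_mul, ← he, RingEquiv.symm_apply_apply, RingEquiv.symm_apply_apply]

variable {A B : Type u} [CommRing A] [CommRing B]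

/-- `(ψ.symm)[ε] ∘ ψ[ε] = id`. [folklore] -/
theorem mapRingHom_symm_comp (ψ : A ≃+* B) :
    (mapRingHom (ψ.symm : B →+* A)).comp (mapRingHom (ψ : A →+* B)) = RingHom.id A[ε] := by
  refine RingHom.ext fun z ↦ ?_
  ext <;> simp

/-- **`ψ[ε] : A[ε] ≃+* B[ε]`** for a ring isomorphism `ψ`. [folklore] -/
def mapRingEquiv (ψ : A ≃+* B) : A[ε] ≃+* B[ε] :=
  RingEquiv.ofRingHom (mapRingHom (ψ : A →+* B)) (mapRingHom (ψ.symm : B →+* A))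
    (by simpa using mapRingHom_symm_comp ψ.symm) (mapRingHom_symm_comp ψ)

/-- The underlying ring map of `ψ[ε]` is `mapRingHom ψ`. [folklore] -/
theorem coe_mapRingEquiv (ψ : A ≃+* B) : (mapRingEquiv ψ : A[ε] →+* B[ε]) = mapRingHom (ψ : A →+* B) :=
  RingHom.ext fun _ ↦ rfl

/-- Composition of ring-change maps: `(f ∘ g)[ε] = f[ε] ∘ g[ε]`. [folklore] -/
theorem mapRingHom_comp' {C : Type u} [CommRing C] (f : B →+* C) (g : A →+* B) :
    mapRingHom (f.comp g) = (mapRingHom f).comp (mapRingHom g) := by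
  refine RingHom.ext fun z ↦ ?_
  ext <;> simp

end Transport

namespace DoubledLine

open DualNumber TrivSqZeroExt MvPolynomial
universe u
variable (k : Type u) [CommRing k]

/-- The chart ring `A = k[s, p]` (`s = X 0`, `p = X 1`). -/
abbrev A : Type u := MvPolynomial (Fin 2) k

/-- The overlap ring `L = k[s, s⁻¹, p] = A_s`. -/
abbrev L : Type u := Localization.Away (X 0 : MvPolynomial (Fin 2) k)

/-- `Derivation ℤ R R` for the CANONICAL `ℤ`-algebra structure `Ring.toIntAlgebra R` (on a localisation a second,
non-defeq `ℤ`-algebra structure is inferred from the base; this abbreviation pins the one used by `…TwistedAtlas`). -/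
abbrev DerZ (R : Type u) [CommRing R] : Type u := Derivation ℤ R R

/-- Pin the canonical `ℤ`-algebra structure on `L` for instance search (see `DerZ`); scoped to this namespace. -/
noncomputable scoped instance (priority := high) instIntAlgebraL : Algebra ℤ (L k) := Ring.toIntAlgebra (L k)

/-! ### §1 The derivation `c·∂/∂p` on the localisation `L = A_s` -/

/-- `a ↦ a/1 + ε·(c·(∂a/∂p)/1) : A → L[ε]` — a ring map because `∂/∂p` is a derivation (the dual-number form of a
derivation along `A → L`). [folklore] -/
noncomputable def derivHom₀ (c : L k) : A k →+* (L k)[ε] where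
  toFun a := inl (algebraMap (A k) (L k) a) + inr (c * algebraMap (A k) (L k) (pderiv 1 a))
  map_one' := by
    ext
    · simp
    · simp
  map_mul' a b := by
    ext
    · simp [fst_add, fst_mul]
    · simp only [Derivation.leibniz, smul_eq_mul, map_add, map_mul, snd_add, snd_inl, snd_inr, zero_add,
        DualNumber.snd_mul, fst_add, fst_inl, fst_inr, add_zero]
      ring
  map_zero' := by
    ext
    · simp
    · simp
  map_add' a b := by
    ext
    · simp [fst_add]
    · simp only [map_add, mul_add, snd_add, snd_inl, snd_inr, zero_add]

/-- `derivHom₀ c s = s/1` is a unit of `L[ε]` (`∂s/∂p = 0`). [folklore] -/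
theorem isUnit_derivHom₀_X_zero (c : L k) : IsUnit (derivHom₀ k c (X 0)) := by
  have h : derivHom₀ k c (X 0) = inl (algebraMap (A k) (L k) (X 0)) := by
    change (inl (algebraMap (A k) (L k) (X 0)) + inr (c * algebraMap (A k) (L k) (pderiv 1 (X 0 : A k))) :
      (L k)[ε]) = _
    rw [pderiv_X_of_ne (by decide : (0 : Fin 2) ≠ 1), map_zero, mul_zero, inr_zero, add_zero]
  rw [h]
  exact (IsLocalization.Away.algebraMap_isUnit (X 0 : A k)).map (TrivSqZeroExt.inlHom (L k) (L k))

/-- The extension `L → L[ε]` of `derivHom₀ c` through the localisation. [folklore] -/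
noncomputable def derivHom (c : L k) : L k →+* (L k)[ε] :=
  IsLocalization.Away.lift (X 0 : A k) (isUnit_derivHom₀_X_zero k c)

/-- `derivHom c (a/1) = derivHom₀ c a`. [folklore] -/
theorem derivHom_algebraMap (c : L k) (a : A k) :
    derivHom k c (algebraMap (A k) (L k) a) = derivHom₀ k c a :=
  IsLocalization.Away.lift_eq (X 0 : A k) (isUnit_derivHom₀_X_zero k c) a

/-- `(derivHom c z).fst = z`: `derivHom c` is a section of `fst` over `L` (both `fst ∘ derivHom c` and `id` extend
`A → L`). [folklore] -/
theorem fst_derivHom (c : L k) (z : L k) : (derivHom k c z).fst = z := by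
  have key : (fstRingHom (L k)).comp (derivHom k c) = RingHom.id (L k) := by
    refine IsLocalization.ringHom_ext (Submonoid.powers (X 0 : A k)) (RingHom.ext fun a ↦ ?_)
    simp only [RingHom.comp_apply, RingHom.id_apply, derivHom_algebraMap, fstRingHom_apply]
    change (inl (algebraMap (A k) (L k) a) + inr (c * algebraMap (A k) (L k) (pderiv 1 a)) : (L k)[ε]).fst = _
    rw [fst_add, fst_inl, fst_inr, add_zero]
  simpa only [RingHom.comp_apply, fstRingHom_apply, RingHom.id_apply] using DFunLike.congr_fun key z

/-- **The derivation `c·∂/∂p` of `L = k[s, s⁻¹, p]`**: `z ↦ (derivHom c z).snd` (Leibniz from the ring-map property and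
`fst ∘ derivHom c = id`). [folklore] -/
noncomputable def theta (c : L k) : DerZ (L k) :=
  Derivation.mk'
    { toFun := fun z ↦ (derivHom k c z).snd
      map_add' := fun z w ↦ by simp only [map_add, snd_add]
      map_smul' := fun n z ↦ by
        simp only [RingHom.id_apply]
        exact map_zsmul ((TrivSqZeroExt.sndHom (L k) (L k)).toAddMonoidHom.comp (derivHom k c).toAddMonoidHom) n z }
    fun a b ↦ by
      change (derivHom k c (a * b)).snd = a • (derivHom k c b).snd + b • (derivHom k c a).snd
      rw [map_mul, DualNumber.snd_mul, fst_derivHom, fst_derivHom, smul_eq_mul, smul_eq_mul]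
      ring

/-- `theta c (a/1) = c · (∂a/∂p)/1`. [folklore] -/
theorem theta_algebraMap (c : L k) (a : A k) :
    theta k c (algebraMap (A k) (L k) a) = c * algebraMap (A k) (L k) (pderiv 1 a) := by
  change (derivHom k c (algebraMap (A k) (L k) a)).snd = _
  rw [derivHom_algebraMap]
  change (inl (algebraMap (A k) (L k) a) + inr (c * algebraMap (A k) (L k) (pderiv 1 a)) : (L k)[ε]).snd = _
  rw [snd_add, snd_inl, snd_inr, zero_add]

/-- In particular `theta c (p/1) = c`. [folklore] -/
theorem theta_algebraMap_X_one (c : L k) : theta k c (algebraMap (A k) (L k) (X 1)) = c := by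
  rw [theta_algebraMap, pderiv_X_self, map_one, mul_one]

/-! ### §2 The sheared doubled plane: `Z = V(p)` does not lift -/

/-- The transition derivations: `θ_αβ = (β − α)·s⁻¹∂/∂p` on `Fin 2` (`θ₀₁ = s⁻¹∂_p`, `θ₁₀ = −θ₀₁`, `θ_αα = 0`). -/
noncomputable def thetaFamily (α β : Fin 2) : DerZ (L k) :=
  (((β : ℕ) : ℤ) - ((α : ℕ) : ℤ)) • theta k (IsLocalization.Away.invSelf (X 0 : A k))

/-- `θ₀₁ = s⁻¹·∂/∂p`. [folklore] -/
theorem thetaFamily_zero_one : thetaFamily k 0 1 = theta k (IsLocalization.Away.invSelf (X 0 : A k)) := by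
  rw [thetaFamily]
  simp

/-- The evaluation `L = k[s, s⁻¹, p] → k[x]_x`, `s ↦ x`, `p ↦ 0` (through `A → k[x] → k[x]_x`). [folklore] -/
noncomputable def ev₀ : A k →+* Localization.Away (Polynomial.X : Polynomial k) :=
  (algebraMap (Polynomial k) (Localization.Away (Polynomial.X : Polynomial k))).comp
    (MvPolynomial.eval₂Hom Polynomial.C ![Polynomial.X, 0])

/-- `ev₀ s = x/1` is a unit. [folklore] -/
theorem isUnit_ev₀_X_zero : IsUnit (ev₀ k (X 0)) := by
  rw [ev₀, RingHom.comp_apply, MvPolynomial.coe_eval₂Hom, MvPolynomial.eval₂_X]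
  exact IsLocalization.Away.algebraMap_isUnit (Polynomial.X : Polynomial k)

/-- The evaluation extended to `L`. [folklore] -/
noncomputable def ev : L k →+* Localization.Away (Polynomial.X : Polynomial k) :=
  IsLocalization.Away.lift (X 0 : A k) (isUnit_ev₀_X_zero k)

/-- `ev (a/1) = ev₀ a`. [folklore] -/
theorem ev_algebraMap (a : A k) : ev k (algebraMap (A k) (L k) a) = ev₀ k a :=
  IsLocalization.Away.lift_eq (X 0 : A k) (isUnit_ev₀_X_zero k) a

/-- `ev (p/1) = 0`. [folklore] -/
theorem ev_algebraMap_X_one : ev k (algebraMap (A k) (L k) (X 1)) = 0 := by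
  rw [ev_algebraMap, ev₀, RingHom.comp_apply, MvPolynomial.coe_eval₂Hom, MvPolynomial.eval₂_X]
  simp

/-- `ev (s/1) = x/1`. [folklore] -/
theorem ev_algebraMap_X_zero :
    ev k (algebraMap (A k) (L k) (X 0)) =
      algebraMap (Polynomial k) (Localization.Away (Polynomial.X : Polynomial k)) Polynomial.X := by
  rw [ev_algebraMap, ev₀, RingHom.comp_apply, MvPolynomial.coe_eval₂Hom, MvPolynomial.eval₂_X]
  simp

/-- `ev` kills `I_L = (p)·L`. [folklore] -/
theorem ev_eq_zero_of_mem {z : L k}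
    (hz : z ∈ (Ideal.span {(X 1 : A k)}).map (algebraMap (A k) (L k))) : ev k z = 0 := by
  rw [Ideal.map_span, Set.image_singleton] at hz
  obtain ⟨w, rfl⟩ := Ideal.mem_span_singleton'.1 hz
  rw [map_mul, ev_algebraMap_X_one, mul_zero]

/-- `ev` of an element of `A/1` is a polynomial over `1`. [folklore] -/
theorem ev_algebraMap_eq (a : A k) :
    ev k (algebraMap (A k) (L k) a) =
      algebraMap (Polynomial k) (Localization.Away (Polynomial.X : Polynomial k))
        (MvPolynomial.eval₂ Polynomial.C ![Polynomial.X, 0] a) := by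
  rw [ev_algebraMap, ev₀, RingHom.comp_apply, MvPolynomial.coe_eval₂Hom]

/-- Both restrictions of every overlap: the localisation map `A → L = A_s`. -/
noncomputable abbrev res : Fin 2 → Fin 2 → (A k →+* L k) := fun _ _ ↦ algebraMap (A k) (L k)

/-- The subscheme `Z = V(p)` on the charts … -/
noncomputable abbrev idealZ : Fin 2 → Ideal (A k) := fun _ ↦ Ideal.span {(X 1 : A k)}

/-- … and on the overlaps: `(p)·L`. -/
noncomputable abbrev idealZ₂ : Fin 2 → Fin 2 → Ideal (L k) :=
  fun _ _ ↦ (Ideal.span {(X 1 : A k)}).map (algebraMap (A k) (L k))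

/-- The untwisted restrictions carry flat lifts (`…TwistedAtlas`: localisation discharger). [folklore] -/
theorem preservesLifts_res (α β : Fin 2) :
    PreservesLifts (fstRingHom (A k)) (ε : (A k)[ε]) (fstRingHom (L k)) (ε : (L k)[ε]) (mapRingHom (res k α β))
      (idealZ k α) (idealZ₂ k α β) :=
  preservesLifts_mapRingHom_of_isLocalization (Submonoid.powers (X 0 : A k)) _

/-- **The sheared doubled plane IS a thickened atlas** — every hypothesis of `ThickenedAtlas` is discharged
(`thickenedAtlas_twisted` with the localisation discharger on both sides). [folklore] -/
theorem thickenedAtlas_doubledLine :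
    ThickenedAtlas (fun _ : Fin 2 ↦ fstRingHom (A k)) (fun _ ↦ (ε : (A k)[ε])) (fun _ _ ↦ fstRingHom (L k))
      (fun _ _ ↦ (ε : (L k)[ε])) (fun α β ↦ mapRingHom (res k α β)) (res k)
      (fun α β ↦ (twist (thetaFamily k α β) : (L k)[ε] →+* (L k)[ε]).comp (mapRingHom (res k α β))) (res k)
      (idealZ k) (idealZ₂ k) :=
  thickenedAtlas_twisted (res k) (res k) (idealZ k) (idealZ₂ k) (thetaFamily k) (preservesLifts_res k)
    (preservesLifts_res k)

/-- **Local lifts exist** on every chart: the trivial lifts `(p)·A[ε]` («extensions exist locally» holds here, so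
what fails below is the GLOBAL gluing, i.e. the Čech class). [folklore] -/
theorem isLift_trivialLift_doubledLine :
    ∀ α : Fin 2, IsLift (fstRingHom (A k)) (ε : (A k)[ε]) (idealZ k α)
      ((idealZ k α).map (algebraMap (A k) (A k)[ε])) :=
  isLift_map_chartSection (thickenedAtlas_doubledLine k) (fun _ ↦ algebraMap (A k) (A k)[ε])
    fun _ ↦ fstRingHom_algebraMap

/-- **Positive companion: the UNTWISTED doubled plane (`θ = 0`) DOES carry a lift of `Z`** — by
`exists_isAtlasLift_twisted_iff` with `φ = 0` (both sides of the coboundary equation vanish: `derivToNormal_zero`,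
`resNormal_zero`).  So `IsAtlasLift` is satisfiable for data of exactly this shape, and the obstruction below is
carried by the twist alone. [folklore] -/
theorem exists_isAtlasLift_doubledLine_untwisted :
    ∃ K : Fin 2 → Ideal (A k)[ε],
      IsAtlasLift (fun _ : Fin 2 ↦ fstRingHom (A k)) (fun _ ↦ (ε : (A k)[ε])) (fun α β ↦ mapRingHom (res k α β))
        (fun α β ↦ (twist (0 : DerZ (L k)) : (L k)[ε] →+* (L k)[ε]).comp (mapRingHom (res k α β)))
        (idealZ k) K := by
  have 𝔄 := thickenedAtlas_twisted (res k) (res k) (idealZ k) (idealZ₂ k) (fun _ _ ↦ (0 : DerZ (L k)))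
    (preservesLifts_res k) (preservesLifts_res k)
  have hsec := isLift_map_chartSection 𝔄 (fun _ ↦ algebraMap (A k) (A k)[ε]) fun _ ↦ fstRingHom_algebraMap
  refine (exists_isAtlasLift_twisted_iff (res k) (res k) (idealZ k) (idealZ₂ k) (fun _ _ ↦ (0 : DerZ (L k)))
    (preservesLifts_res k) (preservesLifts_res k)).2 ⟨fun _ ↦ 0, fun α β ↦ ?_⟩
  rw [derivToNormal_zero, resR, resL, resNormal_zero (𝔄.homr α β) (𝔄.liftsr α β) (hsec β),
    resNormal_zero (𝔄.homl α β) (𝔄.liftsl α β) (hsec α), sub_zero]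

/-- Two-variable evaluation at `(u, 0)` is one-variable evaluation at `u` of the specialisation `p ↦ 0`. [folklore] -/
theorem eval₂Hom_pair_zero {B : Type u} [CommRing B] [Algebra k B] (u : B) (y : A k) :
    MvPolynomial.eval₂Hom (algebraMap k B) ![u, 0] y =
      Polynomial.eval₂ (algebraMap k B) u (MvPolynomial.eval₂Hom Polynomial.C ![Polynomial.X, 0] y) := by
  have key : MvPolynomial.eval₂Hom (algebraMap k B) ![u, 0] =
      (Polynomial.eval₂RingHom (algebraMap k B) u).comp (MvPolynomial.eval₂Hom Polynomial.C ![Polynomial.X, 0]) := by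
    refine MvPolynomial.ringHom_ext (fun c ↦ ?_) (fun i ↦ ?_)
    · simp
    · fin_cases i <;> simp
  exact DFunLike.congr_fun key y

variable [Nontrivial k]

/-- **WITNESS WITH NON-ZERO ČECH CLASS.**  In the twisted dual-number atlas of the sheared doubled plane — charts
`k[s,p][ε]` (twice), overlap `k[s,s⁻¹,p][ε]`, left restriction the localisation map, right restriction
`(id + ε θ_αβ) ∘` localisation with `θ₀₁ = s⁻¹∂/∂p` — the subscheme `Z = V(p)` (ideal `(p)` on both charts, `(p)·L`
on the overlaps) has NO lift: by `exists_isAtlasLift_twisted_iff` a lift would make `θ̄₀₁|_{(p)} : p ↦ s⁻¹` a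
coboundary `φ₁| − φ₀|`, i.e. `s⁻¹ ≡ G₁(s,p) − G₀(s,p) (mod p)` with POLYNOMIALS `G_α`; applying `s ↦ x, p ↦ 0` into
`k[x]_x` gives `x·G = 1` in `k[x]`, contradicting `Polynomial.not_isUnit_X`.  So the Čech obstruction class of
Thm. 6.2 (b) is genuinely non-zero here. [cite: Hartshorne2010, §6 Thm. 6.2 (b)] -/
theorem not_exists_isAtlasLift_doubledLine :
    ¬ ∃ K : Fin 2 → Ideal (A k)[ε],
      IsAtlasLift (fun _ : Fin 2 ↦ fstRingHom (A k)) (fun _ ↦ (ε : (A k)[ε])) (fun α β ↦ mapRingHom (res k α β))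
        (fun α β ↦ (twist (thetaFamily k α β) : (L k)[ε] →+* (L k)[ε]).comp (mapRingHom (res k α β)))
        (idealZ k) K := by
  rintro hK
  have 𝔄 := thickenedAtlas_twisted (res k) (res k) (idealZ k) (idealZ₂ k) (thetaFamily k) (preservesLifts_res k)
    (preservesLifts_res k)
  have hsec := isLift_map_chartSection 𝔄 (fun _ ↦ algebraMap (A k) (A k)[ε]) fun _ ↦ fstRingHom_algebraMap
  obtain ⟨φ, hφ⟩ := (exists_isAtlasLift_twisted_iff (res k) (res k) (idealZ k) (idealZ₂ k) (thetaFamily k)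
    (preservesLifts_res k) (preservesLifts_res k)).1 hK
  -- evaluate the (0,1) coboundary equation at `p/1 ∈ I_L`
  have hX1 : (X 1 : A k) ∈ idealZ k 0 := Ideal.subset_span rfl
  have hX1' : (X 1 : A k) ∈ idealZ k 1 := Ideal.subset_span rfl
  have hmem : algebraMap (A k) (L k) (X 1) ∈ idealZ₂ k 0 1 := Ideal.mem_map_of_mem _ (Ideal.subset_span rfl)
  obtain ⟨y₀, hy₀⟩ := Ideal.Quotient.mk_surjective (φ 0 ⟨X 1, hX1⟩)
  obtain ⟨y₁, hy₁⟩ := Ideal.Quotient.mk_surjective (φ 1 ⟨X 1, hX1'⟩)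
  have e0 : resL 𝔄 hsec 0 1 (φ 0) ⟨algebraMap (A k) (L k) (X 1), hmem⟩ =
      Ideal.Quotient.mk (idealZ₂ k 0 1) (algebraMap (A k) (L k) y₀) :=
    resNormal_apply (𝔄.homl 0 1) (𝔄.liftsl 0 1) (hsec 0) (φ 0) ⟨X 1, hX1⟩ y₀ hy₀ hmem
  have e1 : resR 𝔄 hsec 0 1 (φ 1) ⟨algebraMap (A k) (L k) (X 1), hmem⟩ =
      Ideal.Quotient.mk (idealZ₂ k 0 1) (algebraMap (A k) (L k) y₁) :=
    resNormal_apply (𝔄.homr 0 1) (𝔄.liftsr 0 1) (hsec 1) (φ 1) ⟨X 1, hX1'⟩ y₁ hy₁ hmem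
  have h01 := LinearMap.congr_fun (hφ 0 1) ⟨algebraMap (A k) (L k) (X 1), hmem⟩
  simp only [LinearMap.sub_apply, derivToNormal_apply] at h01
  have key : Ideal.Quotient.mk (idealZ₂ k 0 1)
      (theta k (IsLocalization.Away.invSelf (X 0 : A k)) (algebraMap (A k) (L k) (X 1))) =
        Ideal.Quotient.mk (idealZ₂ k 0 1) (algebraMap (A k) (L k) y₁) -
          Ideal.Quotient.mk (idealZ₂ k 0 1) (algebraMap (A k) (L k) y₀) := by
    rw [← e0, ← e1, ← thetaFamily_zero_one]
    exact h01
  rw [theta_algebraMap_X_one, ← map_sub, Ideal.Quotient.eq, ← map_sub] at key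
  -- `s⁻¹ − (y₁ − y₀)/1 ∈ (p)·L`; map to `k[x]_x`
  have hev := ev_eq_zero_of_mem k key
  rw [map_sub, ev_algebraMap_eq, sub_eq_zero] at hev
  -- `ev s⁻¹ · x/1 = 1`
  have hinv : ev k (IsLocalization.Away.invSelf (X 0 : A k)) *
      algebraMap (Polynomial k) (Localization.Away (Polynomial.X : Polynomial k)) Polynomial.X = 1 := by
    rw [← ev_algebraMap_X_zero, ← map_mul, mul_comm, IsLocalization.Away.mul_invSelf, map_one]
  rw [hev, ← map_mul] at hinv
  have hinj : Function.Injective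
      (algebraMap (Polynomial k) (Localization.Away (Polynomial.X : Polynomial k))) :=
    IsLocalization.injective _ (Submonoid.powers_le.2 (mem_nonZeroDivisors_iff_right.2 fun x hx ↦
      (Polynomial.isRegular_X (R := k)).right (show x * Polynomial.X = 0 * Polynomial.X by rw [hx, zero_mul])))
  have hunit : IsUnit (Polynomial.X : Polynomial k) :=
    IsUnit.of_mul_eq_one_right _ (hinj (by rw [hinv, map_one]))
  exact Polynomial.not_isUnit_X hunit

/-- **THE ČECH CLASS IS NON-ZERO**, in the words of `…CechObstruction`: the cochain `(T_β| − T_α|)` of the trivial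
local lifts of `Z` on the sheared doubled plane is NOT a coboundary `φ_β| − φ_α|` (Thm. 6.2 (b) atlas form,
`exists_isAtlasLift_iff`, contraposed with `not_exists_isAtlasLift_doubledLine`).
[cite: Hartshorne2010, §6 Thm. 6.2 (b)] -/
theorem cechCochain_doubledLine_not_coboundary :
    ¬ ∃ φ : ∀ α : Fin 2, idealZ k α →ₗ[A k] A k ⧸ idealZ k α, ∀ α β,
      cechCochain (thickenedAtlas_doubledLine k) (isLift_trivialLift_doubledLine k) α β =
        resR (thickenedAtlas_doubledLine k) (isLift_trivialLift_doubledLine k) α β (φ β) -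
          resL (thickenedAtlas_doubledLine k) (isLift_trivialLift_doubledLine k) α β (φ α) :=
  fun h ↦ not_exists_isAtlasLift_doubledLine k
    ((exists_isAtlasLift_iff (thickenedAtlas_doubledLine k) (isLift_trivialLift_doubledLine k)).2 h)

end DoubledLine

end EmbeddedDeformation

end Summit.Ventures.HSemireg
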